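import Summits.QuantumFields.YangMills.Theorems.BalabanUVNodesN11NoExpansionDiagonalClauseStep
import Summits.QuantumFields.YangMills.Theorems.BalabanUVNodesN11DiagonalPinAboveZero
import Literature.MathematicalPhysics.QuantumFieldTheory.Balaban1983to89.B16RLeafRecord13LiveClauseW

/-!
# DAG node N11 — THEOREM 1 OF [III] ALONG THE WHOLE LARGE-FIELD DIAGONAL, CLOSED IN KERNEL AT THE CURED v1.6 RECORD: for every level `k ≤ K` the post-𝐑 slot of `ρ_k`
# at the all-large-field (2.18) index of length `k` HAS THE §2 DICHOTOMY — by induction on `k`, each step = dag-n11-d's clause-keyed 𝐓-side step at `Stage13RParams.ofCured θ₀`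
# (`…NoExpansionDiagonalClauseStep`, pins discharged by node00-def-K0a's `ZrOfRecord₁₃`) + this seat's clause-level 𝐑-transfer on the live line (`…B16RLeafRecord13LiveClauseW`)

Cell `pub-ymgap`, YM-PLAN Track A (HUMAN RULING D-0062), seat `pub-ymgap-dag-n11-e` (g9; R134 fan-out row N11∕s3 «`ThmP245Printed` via `rOperation` from N13's
`ROpLeaf` (pairs with n13-c)»), route `BalabanUVNodes` rev 22∕23, item K1⁶ `StabilityBAtRecordR13SepCoPR` = stmt-QuantumFields-20507 (helper, count-neutral; dag-lead
WORDS-142).  [III] = [Balaban1988Convergent], [IV] = [Balaban1989LargeFieldI].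

WHY THIS FILE.  Theorem 1 of [III] (p. 262) is the induction «§2 form of `ρ_k` ⇒ 𝐓-image form of `𝐓ρ_k` (Theorem p. 245) ⇒ §2 form of `ρ_{k+1}` (𝐑, p. 244 ∕ [IV])».
Sequence by sequence the two arrows are: dag-n11-d's 𝐓-side CLAUSE STEP (p. 270 (3.24)–(3.25) along the all-large-field history: from the §2 dichotomy of `ρ_k`'s slot at
`init s′` to the 𝐓-image dichotomy of `slotT_{k+1}(s′)`, at K0a's cured family `Stage13RParams.ofCured θ₀` from the v1.5 core provisos of `θ₀` — `clause_succ_ofCured_of_provisosCore_of_clause`,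
this seat's ask of 13:04Z, answered by dag-n11-d INTENT-9) and this seat's 𝐑-side CLAUSE TRANSFER ([IV] (0.3) on the live line: a dead `s′` is absent from `ρ_{k+1}`, a live one
is a fixed point of the selector with `slot = slotT` a.e. on the support — `slotClause_succ_of_slotTClause_of_liveSel_of_rstep`).  Along the diagonal `σ_k := seqAllLargeOfRecord … k`
(`Ω_j = Λ_j = ∅` at every `j`; `(σ_{k+1}).init = σ_k` is dag-n11-d's `…DiagonalPinAboveZero.init_seqAllLargeOfRecord`, cited) the two compose level by level, and the start `k = 0` is def-T's `sLaw₁₃CoPR_zero` (`ρ₀` has no terms).  HENCE: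

§1 ★★★ `diag_slotClause_all_ofCured_of_provisosCore_of_liveSel` — at every `θ₀ : Stage13Params` with `θ₀.Provisos₁₃Core` (the K0⁶ conjunct of the presenting parameter),
   node00-def-T's live-selector clause and `1 ≤ M`, under the DISPLAYED measurability ∕ uniform bound of the old branch `U ↦ 𝐓_k(σ_k, ∅)e^{A_k(σ_k)}(U)` at every level
   (the tree has the restricted-averaging marginal density only as an RN-representative — dag-n11-d's standing remark): FOR EVERY `k ≤ K` there are term values `t` and a
   constant `E` with «`slot_k(σ_k) = 0 ∨ slot_k(σ_k) = 𝐓_k(σ_k)e^{A_k(σ_k)}` `dV_k`-a.e. on `supp χ_k(σ_k)`» at the run's v1.6 weights `WtOfRecord₁₃R (ofCured θ₀) p` and def-R's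
   support-edition background — THEOREM 1's INDUCTION ALONG THE LARGE-FIELD DIAGONAL, both arrows by name at every level, no pin hypothesis.
   `diag_slotClause_succ_forall_terms_ofCured_of_provisosCore_of_liveSel` — above level 0 the clause holds for EVERY term-value witness (the diagonal is term-free).
§2 ★★★ `diag_slotClause_all_ofCured_theta13LiveOfRecord_of_provisosCore` — the same AT THE CURED WITNESS OF RECORD `Stage13RParams.ofCured (theta13LiveOfRecord F N)`
   from `Provisos₁₃Core` there (+ the displayed old-branch data): the selector clause and `M = 1` are theorems at the witness.

HONEST FRAMING.  Count-neutral kernel bookkeeping; an induction over two seats' tree theorems; it covers the ONE no-expansion term of (2.18) per level — every sequence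
with some `Ω_j ≠ ∅` is [III] Sect. 1 ∕ §3 ∕ Thm 2 proper (the load-bearing content of (S1ᵀ), NOT here); the dichotomy's zero branch is NOT excluded here (whether the
diagonal slot is non-trivial at the witness is a separate question — dag-n11-d's `…FirstStepFailsAtEveryWitness` lineage at the small-`εreg` witnesses); `hmB ∕ hCB` stay
DISPLAYED; nothing of Bałaban asserted; N11 NOT discharged; K1⁶ NOT closed; counts unmoved (typed 28∕28 · discharged 5∕28).  One finite `𝕋⁴_{L^K}` programme at fixed
`ε = L^{−K}`; NOT continuum ∕ OS ∕ mass-gap ∕ Clay.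
-/

noncomputable section

open MeasureTheory
open scoped BigOperators Matrix.Norms.L2Operator

namespace Summit.QuantumFields.YangMills.Theorems.BalabanUVNodesN11DiagonalInductionCoPR

open Literature.MathematicalPhysics.QuantumFieldTheory.Balaban1983to89 T4Continuum Node00 Node00.Tk DagBinding
open Literature.MathematicalPhysics.QuantumFieldTheory.Balaban1983to89.B16RLeafRecord13LiveClauseW
open Literature.MathematicalPhysics.QuantumFieldTheory.Balaban1983to89.B16RLeafRecord13AtLive (liveRepin₁₃_liveSel)
open BalabanUVNodesN11NoExpansionDiagonalClauseStep (clause_succ_ofCured_of_provisosCore_of_clause)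
open BalabanUVNodesN11DiagonalPinAboveZero (init_seqAllLargeOfRecord)

variable {F : T4Family} {N : ℕ} [NeZero N]

/-! ## §1. The induction at K0a's cured family `Stage13RParams.ofCured θ₀` from the v1.5 core provisos of `θ₀` -/

section OfCured

variable (θ₀ : Stage13Params F N) (p : B12.RunParams)

/-- **★★★ THEOREM 1 ALONG THE LARGE-FIELD DIAGONAL AT THE CURED FAMILY — for every `k ≤ K` the post-𝐑 slot of `ρ_k` at the all-large-field index `σ_k` has the §2
dichotomy.**  Hypotheses: `θ₀.Provisos₁₃Core` (rows `rstep` — the 𝐑-side —, `zetaUnity`, `measω` — the 𝐓-side), node00-def-T's live-selector clause of `θ₀`, `1 ≤ M`, and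
the DISPLAYED measurability ∕ uniform bound (constant `C k`) of the old branch `U ↦ 𝐓_k(σ_k, ∅)e^{A_k(σ_k)}(U)` for every term value and constant at every level `k < K`.
Induction on `k`: the start is def-T's `sLaw₁₃CoPR_zero` read at `σ_0`; the step is dag-n11-d's `clause_succ_ofCured_of_provisosCore_of_clause` (generation-`k` pin,
locality and `quad ≡ 0` discharged by K0a's `ZrOfRecord₁₃`; constant carried, `E_{k+1} = E_k`) at `s′ := σ_{k+1}` (whose `init` is `σ_k`, dag-n11-d's `init_seqAllLargeOfRecord`) followed by this seat's
`slotClause_succ_of_slotTClause_of_liveSel_of_rstep` at `θ₀` with `W := WtOfRecord₁₃R (ofCured θ₀) p`.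
[cite: Balaban1988Convergent, Thm 1 p.262, Theorem p.245, (3.24)–(3.25) p.270, (2.18) p.257, (1.11) p.248, (3.16)–(3.20) pp.268–269; Balaban1989LargeFieldI, (0.3) p.176, p.177 (i)–(ii)] -/
theorem diag_slotClause_all_ofCured_of_provisosCore_of_liveSel (h : θ₀.Provisos₁₃Core F N)
    (hsel : θ₀.ppSel = ppSelLiveOfRecord F N θ₀.ν θ₀.τ9 (EOfRecord₁₃ F N θ₀) (wOfRecord₉ F N θ₀.toStage9Params)) (hM : 1 ≤ θ₀.τ9.M) (C : ℕ → ℝ)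
    (hmB : ∀ k, k < p.K → ∀ (t : Sect2.TermValues (F.P p.K) (MatA N) (FluctV N) θ₀.τ9.M) (E : ℝ),
      Measurable fun U₀ : GaugeField (F.P p.K) k (SU N) =>
        tkBranchOfRecord F N (FluctV N) θ₀.ν θ₀.τ9.M _ p.K (WtOfRecord₁₃R F N (Stage13RParams.ofCured F N θ₀) p)
          (seqAllLargeOfRecord F θ₀.ν θ₀.τ9.M (gOfRecord₁₃ F N θ₀ p) p.K k) (fun _ => ∅) k
          (fun ω => sect2Operand F N (FluctV N) p.K (settingOfRecord₁₃ F N θ₀ p) (θ₀.Rz p.K) (seqAllLargeOfRecord F θ₀.ν θ₀.τ9.M (gOfRecord₁₃ F N θ₀ p) p.K k) t E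
            (UbgOfRecord₁₃CoP F N θ₀ p k (seqAllLargeOfRecord F θ₀.ν θ₀.τ9.M (gOfRecord₁₃ F N θ₀ p) p.K k))
            ((fun _ => ∅ : ℕ → Set (Site (F.P p.K) 0)), fun j => (ω j).2) (fun j => (ω j).1))
          (baseCfg (V := FluctV N) k U₀))
    (hCB : ∀ k, k < p.K → ∀ (t : Sect2.TermValues (F.P p.K) (MatA N) (FluctV N) θ₀.τ9.M) (E : ℝ) (U₀ : GaugeField (F.P p.K) k (SU N)),
      |tkBranchOfRecord F N (FluctV N) θ₀.ν θ₀.τ9.M _ p.K (WtOfRecord₁₃R F N (Stage13RParams.ofCured F N θ₀) p)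
          (seqAllLargeOfRecord F θ₀.ν θ₀.τ9.M (gOfRecord₁₃ F N θ₀ p) p.K k) (fun _ => ∅) k
          (fun ω => sect2Operand F N (FluctV N) p.K (settingOfRecord₁₃ F N θ₀ p) (θ₀.Rz p.K) (seqAllLargeOfRecord F θ₀.ν θ₀.τ9.M (gOfRecord₁₃ F N θ₀ p) p.K k) t E
            (UbgOfRecord₁₃CoP F N θ₀ p k (seqAllLargeOfRecord F θ₀.ν θ₀.τ9.M (gOfRecord₁₃ F N θ₀ p) p.K k))
            ((fun _ => ∅ : ℕ → Set (Site (F.P p.K) 0)), fun j => (ω j).2) (fun j => (ω j).1))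
          (baseCfg (V := FluctV N) k U₀)| ≤ C k) :
    ∀ k, k ≤ p.K → ∃ (t : Sect2.TermValues (F.P p.K) (MatA N) (FluctV N) θ₀.τ9.M) (E : ℝ),
      slotsOfRecord F N θ₀.ν θ₀.τ9 (EOfRecord₁₃ F N θ₀) (wOfRecord₉ F N θ₀.toStage9Params) θ₀.ppSel p (gOfRecord₁₃ F N θ₀ p) k
          (seqAllLargeOfRecord F θ₀.ν θ₀.τ9.M (gOfRecord₁₃ F N θ₀ p) p.K k) = 0 ∨
        ∀ᵐ U ∂fieldMeasure (F.P p.K) k (SU N),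
          chiSeqOfRecord F N θ₀.ν θ₀.τ9.M (gOfRecord₁₃ F N θ₀ p) p.K k (seqAllLargeOfRecord F θ₀.ν θ₀.τ9.M (gOfRecord₁₃ F N θ₀ p) p.K k) U ≠ 0 →
            slotsOfRecord F N θ₀.ν θ₀.τ9 (EOfRecord₁₃ F N θ₀) (wOfRecord₉ F N θ₀.toStage9Params) θ₀.ppSel p (gOfRecord₁₃ F N θ₀ p) k
                (seqAllLargeOfRecord F θ₀.ν θ₀.τ9.M (gOfRecord₁₃ F N θ₀ p) p.K k) U =
              sect2Slot F N (FluctV N) p.K (settingOfRecord₁₃ F N θ₀ p) (θ₀.Rz p.K) (WtOfRecord₁₃R F N (Stage13RParams.ofCured F N θ₀) p)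
                (seqAllLargeOfRecord F θ₀.ν θ₀.τ9.M (gOfRecord₁₃ F N θ₀ p) p.K k) t E
                (UbgOfRecord₁₃CoP F N θ₀ p k (seqAllLargeOfRecord F θ₀.ν θ₀.τ9.M (gOfRecord₁₃ F N θ₀ p) p.K k)) U := by
  intro k
  induction k with
  | zero =>
    intro _
    -- the start: `ρ₀` has the §2 form (def-T's `sLaw₁₃CoPR_zero`), read at the all-large index of length `0`
    obtain ⟨t, Ek, -, hs⟩ := (sLaw₁₃CoPR_iff F N (Stage13RParams.ofCured F N θ₀) p 0).mp (sLaw₁₃CoPR_zero F N (Stage13RParams.ofCured F N θ₀) p)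
    exact ⟨t _, Ek _, (hs (seqAllLargeOfRecord F θ₀.ν θ₀.τ9.M (gOfRecord₁₃ F N θ₀ p) p.K 0)).2⟩
  | succ k ih =>
    intro hk1
    have hk : k < p.K := Nat.lt_of_succ_le hk1
    obtain ⟨t₀, E₀, hid⟩ := ih hk.le
    -- transport the level-`k` clause to the old sequence of `σ_{k+1}` (which IS `σ_k`)
    have hinit := init_seqAllLargeOfRecord (F := F) θ₀.ν θ₀.τ9.M p (gOfRecord₁₃ F N θ₀ p) k
    refine ⟨t₀, E₀, ?_⟩
    -- 𝐓-side: dag-n11-d's clause step at the cured family (pins discharged), constant carried; 𝐑-side: this seat's clause transfer on the live line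
    have hT := clause_succ_ofCured_of_provisosCore_of_clause θ₀ p h hk hM
      (seqAllLargeOfRecord F θ₀.ν θ₀.τ9.M (gOfRecord₁₃ F N θ₀ p) p.K (k + 1)) (fun j _ _ => rfl) t₀ E₀ (by rw [hinit]; exact hid)
      (C := C k) (by rw [hinit]; exact hmB k hk t₀ E₀) (by rw [hinit]; exact hCB k hk t₀ E₀) t₀
    exact slotClause_succ_of_slotTClause_of_liveSel_of_rstep F N θ₀ p (fun p k _ hk => h.rstep p k hk) hsel k hk
      (WtOfRecord₁₃R F N (Stage13RParams.ofCured F N θ₀) p) _ t₀ E₀ _ fun _ => hT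

/-- **… AND ABOVE LEVEL 0 FOR EVERY TERM-VALUE WITNESS**: along the all-large-field history the 𝐓-side step is term-free (dag-n11-d: the (2.23) action there is the
bare Wilson action for every term witness), so from the level-`k` clause (§2's witness) the level-`k+1` post-𝐑 clause holds for EVERY `t′`, with the carried constant.
[cite: Balaban1988Convergent, Thm 1 p.262, (2.20)–(2.23) p.258, (3.24)–(3.25) p.270; Balaban1989LargeFieldI, (0.3) p.176, p.177 (i)–(ii)] -/
theorem diag_slotClause_succ_forall_terms_ofCured_of_provisosCore_of_liveSel (h : θ₀.Provisos₁₃Core F N)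
    (hsel : θ₀.ppSel = ppSelLiveOfRecord F N θ₀.ν θ₀.τ9 (EOfRecord₁₃ F N θ₀) (wOfRecord₉ F N θ₀.toStage9Params)) (hM : 1 ≤ θ₀.τ9.M) (C : ℕ → ℝ)
    (hmB : ∀ k, k < p.K → ∀ (t : Sect2.TermValues (F.P p.K) (MatA N) (FluctV N) θ₀.τ9.M) (E : ℝ),
      Measurable fun U₀ : GaugeField (F.P p.K) k (SU N) =>
        tkBranchOfRecord F N (FluctV N) θ₀.ν θ₀.τ9.M _ p.K (WtOfRecord₁₃R F N (Stage13RParams.ofCured F N θ₀) p)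
          (seqAllLargeOfRecord F θ₀.ν θ₀.τ9.M (gOfRecord₁₃ F N θ₀ p) p.K k) (fun _ => ∅) k
          (fun ω => sect2Operand F N (FluctV N) p.K (settingOfRecord₁₃ F N θ₀ p) (θ₀.Rz p.K) (seqAllLargeOfRecord F θ₀.ν θ₀.τ9.M (gOfRecord₁₃ F N θ₀ p) p.K k) t E
            (UbgOfRecord₁₃CoP F N θ₀ p k (seqAllLargeOfRecord F θ₀.ν θ₀.τ9.M (gOfRecord₁₃ F N θ₀ p) p.K k))
            ((fun _ => ∅ : ℕ → Set (Site (F.P p.K) 0)), fun j => (ω j).2) (fun j => (ω j).1))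
          (baseCfg (V := FluctV N) k U₀))
    (hCB : ∀ k, k < p.K → ∀ (t : Sect2.TermValues (F.P p.K) (MatA N) (FluctV N) θ₀.τ9.M) (E : ℝ) (U₀ : GaugeField (F.P p.K) k (SU N)),
      |tkBranchOfRecord F N (FluctV N) θ₀.ν θ₀.τ9.M _ p.K (WtOfRecord₁₃R F N (Stage13RParams.ofCured F N θ₀) p)
          (seqAllLargeOfRecord F θ₀.ν θ₀.τ9.M (gOfRecord₁₃ F N θ₀ p) p.K k) (fun _ => ∅) k
          (fun ω => sect2Operand F N (FluctV N) p.K (settingOfRecord₁₃ F N θ₀ p) (θ₀.Rz p.K) (seqAllLargeOfRecord F θ₀.ν θ₀.τ9.M (gOfRecord₁₃ F N θ₀ p) p.K k) t E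
            (UbgOfRecord₁₃CoP F N θ₀ p k (seqAllLargeOfRecord F θ₀.ν θ₀.τ9.M (gOfRecord₁₃ F N θ₀ p) p.K k))
            ((fun _ => ∅ : ℕ → Set (Site (F.P p.K) 0)), fun j => (ω j).2) (fun j => (ω j).1))
          (baseCfg (V := FluctV N) k U₀)| ≤ C k)
    (k : ℕ) (hk : k < p.K) (t' : Sect2.TermValues (F.P p.K) (MatA N) (FluctV N) θ₀.τ9.M) :
    ∃ E : ℝ,
      slotsOfRecord F N θ₀.ν θ₀.τ9 (EOfRecord₁₃ F N θ₀) (wOfRecord₉ F N θ₀.toStage9Params) θ₀.ppSel p (gOfRecord₁₃ F N θ₀ p) (k + 1)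
          (seqAllLargeOfRecord F θ₀.ν θ₀.τ9.M (gOfRecord₁₃ F N θ₀ p) p.K (k + 1)) = 0 ∨
        ∀ᵐ U ∂fieldMeasure (F.P p.K) (k + 1) (SU N),
          chiSeqOfRecord F N θ₀.ν θ₀.τ9.M (gOfRecord₁₃ F N θ₀ p) p.K (k + 1) (seqAllLargeOfRecord F θ₀.ν θ₀.τ9.M (gOfRecord₁₃ F N θ₀ p) p.K (k + 1)) U ≠ 0 →
            slotsOfRecord F N θ₀.ν θ₀.τ9 (EOfRecord₁₃ F N θ₀) (wOfRecord₉ F N θ₀.toStage9Params) θ₀.ppSel p (gOfRecord₁₃ F N θ₀ p) (k + 1)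
                (seqAllLargeOfRecord F θ₀.ν θ₀.τ9.M (gOfRecord₁₃ F N θ₀ p) p.K (k + 1)) U =
              sect2Slot F N (FluctV N) p.K (settingOfRecord₁₃ F N θ₀ p) (θ₀.Rz p.K) (WtOfRecord₁₃R F N (Stage13RParams.ofCured F N θ₀) p)
                (seqAllLargeOfRecord F θ₀.ν θ₀.τ9.M (gOfRecord₁₃ F N θ₀ p) p.K (k + 1)) t' E
                (UbgOfRecord₁₃CoP F N θ₀ p (k + 1) (seqAllLargeOfRecord F θ₀.ν θ₀.τ9.M (gOfRecord₁₃ F N θ₀ p) p.K (k + 1))) U := by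
  obtain ⟨t₀, E₀, hid⟩ := diag_slotClause_all_ofCured_of_provisosCore_of_liveSel θ₀ p h hsel hM C hmB hCB k hk.le
  have hinit := init_seqAllLargeOfRecord (F := F) θ₀.ν θ₀.τ9.M p (gOfRecord₁₃ F N θ₀ p) k
  refine ⟨E₀, ?_⟩
  have hT := clause_succ_ofCured_of_provisosCore_of_clause θ₀ p h hk hM
    (seqAllLargeOfRecord F θ₀.ν θ₀.τ9.M (gOfRecord₁₃ F N θ₀ p) p.K (k + 1)) (fun j _ _ => rfl) t₀ E₀ (by rw [hinit]; exact hid)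
    (C := C k) (by rw [hinit]; exact hmB k hk t₀ E₀) (by rw [hinit]; exact hCB k hk t₀ E₀) t'
  exact slotClause_succ_of_slotTClause_of_liveSel_of_rstep F N θ₀ p (fun p k _ hk => h.rstep p k hk) hsel k hk
    (WtOfRecord₁₃R F N (Stage13RParams.ofCured F N θ₀) p) _ t' E₀ _ fun _ => hT

end OfCured

/-! ## §2. At the cured witness of record -/

section OfCuredRecord

variable (F N)
variable (p : B12.RunParams)

/-- **★★★ THEOREM 1 ALONG THE LARGE-FIELD DIAGONAL AT K0a's CURED WITNESS OF RECORD `Stage13RParams.ofCured (theta13LiveOfRecord F N)`**: from the K0⁶ conjunct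
`Provisos₁₃Core` AT THE WITNESS and the displayed old-branch data ONLY (the live-selector clause is K0a's `liveRepin₁₃_liveSel`, `M = 1` by the family's numerals) — for
every `k ≤ K`, term values and a constant with the §2 dichotomy of `ρ_k`'s slot at the all-large-field index of length `k`.
[cite: Balaban1988Convergent, Thm 1 p.262, Theorem p.245, (3.24)–(3.25) p.270, (1.11) p.248, (3.16)–(3.22) pp.268–269; Balaban1989LargeFieldI, (0.3)–(0.4) p.176, p.177 (i)–(ii)] -/
theorem diag_slotClause_all_ofCured_theta13LiveOfRecord_of_provisosCore (h : (theta13LiveOfRecord F N).Provisos₁₃Core F N) (C : ℕ → ℝ)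
    (hmB : ∀ k, k < p.K → ∀ (t : Sect2.TermValues (F.P p.K) (MatA N) (FluctV N) (theta13LiveOfRecord F N).τ9.M) (E : ℝ),
      Measurable fun U₀ : GaugeField (F.P p.K) k (SU N) =>
        tkBranchOfRecord F N (FluctV N) (theta13LiveOfRecord F N).ν (theta13LiveOfRecord F N).τ9.M _ p.K
          (WtOfRecord₁₃R F N (Stage13RParams.ofCured F N (theta13LiveOfRecord F N)) p)
          (seqAllLargeOfRecord F (theta13LiveOfRecord F N).ν (theta13LiveOfRecord F N).τ9.M (gOfRecord₁₃ F N (theta13LiveOfRecord F N) p) p.K k) (fun _ => ∅) k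
          (fun ω => sect2Operand F N (FluctV N) p.K (settingOfRecord₁₃ F N (theta13LiveOfRecord F N) p) ((theta13LiveOfRecord F N).Rz p.K)
            (seqAllLargeOfRecord F (theta13LiveOfRecord F N).ν (theta13LiveOfRecord F N).τ9.M (gOfRecord₁₃ F N (theta13LiveOfRecord F N) p) p.K k) t E
            (UbgOfRecord₁₃CoP F N (theta13LiveOfRecord F N) p k
              (seqAllLargeOfRecord F (theta13LiveOfRecord F N).ν (theta13LiveOfRecord F N).τ9.M (gOfRecord₁₃ F N (theta13LiveOfRecord F N) p) p.K k))
            ((fun _ => ∅ : ℕ → Set (Site (F.P p.K) 0)), fun j => (ω j).2) (fun j => (ω j).1))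
          (baseCfg (V := FluctV N) k U₀))
    (hCB : ∀ k, k < p.K → ∀ (t : Sect2.TermValues (F.P p.K) (MatA N) (FluctV N) (theta13LiveOfRecord F N).τ9.M) (E : ℝ) (U₀ : GaugeField (F.P p.K) k (SU N)),
      |tkBranchOfRecord F N (FluctV N) (theta13LiveOfRecord F N).ν (theta13LiveOfRecord F N).τ9.M _ p.K
          (WtOfRecord₁₃R F N (Stage13RParams.ofCured F N (theta13LiveOfRecord F N)) p)
          (seqAllLargeOfRecord F (theta13LiveOfRecord F N).ν (theta13LiveOfRecord F N).τ9.M (gOfRecord₁₃ F N (theta13LiveOfRecord F N) p) p.K k) (fun _ => ∅) k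
          (fun ω => sect2Operand F N (FluctV N) p.K (settingOfRecord₁₃ F N (theta13LiveOfRecord F N) p) ((theta13LiveOfRecord F N).Rz p.K)
            (seqAllLargeOfRecord F (theta13LiveOfRecord F N).ν (theta13LiveOfRecord F N).τ9.M (gOfRecord₁₃ F N (theta13LiveOfRecord F N) p) p.K k) t E
            (UbgOfRecord₁₃CoP F N (theta13LiveOfRecord F N) p k
              (seqAllLargeOfRecord F (theta13LiveOfRecord F N).ν (theta13LiveOfRecord F N).τ9.M (gOfRecord₁₃ F N (theta13LiveOfRecord F N) p) p.K k))
            ((fun _ => ∅ : ℕ → Set (Site (F.P p.K) 0)), fun j => (ω j).2) (fun j => (ω j).1))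
          (baseCfg (V := FluctV N) k U₀)| ≤ C k) :
    ∀ k, k ≤ p.K → ∃ (t : Sect2.TermValues (F.P p.K) (MatA N) (FluctV N) (theta13LiveOfRecord F N).τ9.M) (E : ℝ),
      slotsOfRecord F N (theta13LiveOfRecord F N).ν (theta13LiveOfRecord F N).τ9 (EOfRecord₁₃ F N (theta13LiveOfRecord F N))
          (wOfRecord₉ F N (theta13LiveOfRecord F N).toStage9Params) (theta13LiveOfRecord F N).ppSel p (gOfRecord₁₃ F N (theta13LiveOfRecord F N) p) k
          (seqAllLargeOfRecord F (theta13LiveOfRecord F N).ν (theta13LiveOfRecord F N).τ9.M (gOfRecord₁₃ F N (theta13LiveOfRecord F N) p) p.K k) = 0 ∨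
        ∀ᵐ U ∂fieldMeasure (F.P p.K) k (SU N),
          chiSeqOfRecord F N (theta13LiveOfRecord F N).ν (theta13LiveOfRecord F N).τ9.M (gOfRecord₁₃ F N (theta13LiveOfRecord F N) p) p.K k
              (seqAllLargeOfRecord F (theta13LiveOfRecord F N).ν (theta13LiveOfRecord F N).τ9.M (gOfRecord₁₃ F N (theta13LiveOfRecord F N) p) p.K k) U ≠ 0 →
            slotsOfRecord F N (theta13LiveOfRecord F N).ν (theta13LiveOfRecord F N).τ9 (EOfRecord₁₃ F N (theta13LiveOfRecord F N))
                (wOfRecord₉ F N (theta13LiveOfRecord F N).toStage9Params) (theta13LiveOfRecord F N).ppSel p (gOfRecord₁₃ F N (theta13LiveOfRecord F N) p) k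
                (seqAllLargeOfRecord F (theta13LiveOfRecord F N).ν (theta13LiveOfRecord F N).τ9.M (gOfRecord₁₃ F N (theta13LiveOfRecord F N) p) p.K k) U =
              sect2Slot F N (FluctV N) p.K (settingOfRecord₁₃ F N (theta13LiveOfRecord F N) p) ((theta13LiveOfRecord F N).Rz p.K)
                (WtOfRecord₁₃R F N (Stage13RParams.ofCured F N (theta13LiveOfRecord F N)) p)
                (seqAllLargeOfRecord F (theta13LiveOfRecord F N).ν (theta13LiveOfRecord F N).τ9.M (gOfRecord₁₃ F N (theta13LiveOfRecord F N) p) p.K k) t E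
                (UbgOfRecord₁₃CoP F N (theta13LiveOfRecord F N) p k
                  (seqAllLargeOfRecord F (theta13LiveOfRecord F N).ν (theta13LiveOfRecord F N).τ9.M (gOfRecord₁₃ F N (theta13LiveOfRecord F N) p) p.K k)) U :=
  diag_slotClause_all_ofCured_of_provisosCore_of_liveSel (theta13LiveOfRecord F N) p h
    (liveRepin₁₃_liveSel F N (theta13OfFamily F N eps0OfRecord₁₃ _ _ _)) (le_of_eq rfl) C hmB hCB

end OfCuredRecord

end Summit.QuantumFields.YangMills.Theorems.BalabanUVNodesN11DiagonalInductionCoPR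

end
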